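import Mathlib.LinearAlgebra.Matrix.Block
import Mathlib.LinearAlgebra.Matrix.GeneralLinearGroup.Defs
import Mathlib.Analysis.Complex.Basic
import Mathlib.Algebra.Group.AddChar
import HarnessLib

/-!
# Unipotent subgroups of `GL_n(F)`: the unitriangular group, column groups, pattern subgroups,
# and the characters `ψ(∑ u_{i,i+1})`

Topic `Literature/RepresentationTheory/FiniteGroups`.  Elementary matrix-group infrastructure for
the representation theory of `GL_n(𝔽_q)` (Gelfand–Graev / Whittaker models, Kirillov's dimension
recursion for cuspidal representations):

* `GLn.fixCols F n S`, `GLn.fixRows F n S` — invertible matrices whose columns (rows) indexed by `S`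
  are those of the identity (stabilisers of basis vectors / covectors); subgroups.
* `GLn.unitUpper F n` — the upper unitriangular group `U_n`.
* `GLn.tailGroup F n t = U_n ⊓ fixCols {j < t}` (unipotent matrices supported in columns `≥ t`;
  `tailGroup 1 = U_n`, `tailGroup n = 1`), `GLn.colGroup F n c = U_n ⊓ fixCols {j ≠ c}` (the abelian
  root subgroup of column `c`, `≅ F^c`), `GLn.leviBlock F n k = fixCols {j ≥ k} ⊓ fixRows {i ≥ k}`
  (`GL_k` embedded as `diag(A, 1)`).
* `GLn.colElem c x` — the element `1 + ∑_{i<c} x_i E_{ic}` of `colGroup c`; `colElem_mul`.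
* `GLn.colChar ψ₀ c y` — the characters `ψ₀(∑_{i<c} y_i g_{ic})` of `colGroup c` (`colChar_mul`).
* `GLn.superdiagSum t g = ∑_{t ≤ i+1} g_{i,i+1}` and, for an additive character `ψ₀` of `F`,
  `GLn.theta ψ₀ t g = ψ₀(superdiagSum t g)`; multiplicative on `U_n` (`theta_mul`); `theta ψ₀ 1`
  is the non-degenerate character `ψ_U(u) = ψ₀(∑ u_{i,i+1})`, packaged as `GLn.thetaHom`.

All definitions are bodies-with-API (no facts). [folklore]

## References

* D. Bump, *Automorphic Forms and Representations*, §4.1; R. W. Carter, *Finite Groups of Lie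
  Type*, §8.1 (the groups `U`, `U_w`, the character `ψ`).
-/

open scoped BigOperators Matrix

namespace Literature.RepresentationTheory.FiniteGroups.GLn

variable (F : Type*) [Field F] (n : ℕ)

/-! ### Stabilisers of basis vectors and covectors -/

/-- Invertible matrices whose columns indexed by `S` are identity columns (`g e_j = e_j`, `j ∈ S`). [folklore] -/
def fixCols (S : Set (Fin n)) : Subgroup (GL (Fin n) F) where
  carrier := {g | ∀ j ∈ S, ∀ i, g.val i j = (1 : Matrix (Fin n) (Fin n) F) i j}
  one_mem' := fun _ _ _ => rfl
  mul_mem' {a b} ha hb := fun j hj i => by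
    rw [Units.val_mul, Matrix.mul_apply]
    calc ∑ l, a.val i l * b.val l j
        = ∑ l, a.val i l * (1 : Matrix (Fin n) (Fin n) F) l j :=
          Finset.sum_congr rfl fun l _ => by rw [hb j hj l]
      _ = a.val i j := by rw [← Matrix.mul_apply, Matrix.mul_one]
      _ = _ := ha j hj i
  inv_mem' {a} ha := fun j hj i => by
    -- `a⁻¹ e_j = a⁻¹ (a e_j) = e_j`
    have h1 : ((a⁻¹ : GL (Fin n) F).val * a.val) i j = (1 : Matrix (Fin n) (Fin n) F) i j := by
      rw [← Units.val_mul, inv_mul_cancel, Units.val_one]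
    rw [← h1, Matrix.mul_apply]
    calc (a⁻¹ : GL (Fin n) F).val i j = ((a⁻¹ : GL (Fin n) F).val * (1 : Matrix (Fin n) (Fin n) F)) i j := by
          rw [Matrix.mul_one]
      _ = ∑ l, (a⁻¹ : GL (Fin n) F).val i l * (1 : Matrix (Fin n) (Fin n) F) l j := by rw [Matrix.mul_apply]
      _ = ∑ l, (a⁻¹ : GL (Fin n) F).val i l * a.val l j :=
          Finset.sum_congr rfl fun l _ => by rw [ha j hj l]

/-- Membership in `fixCols`. [folklore] -/
theorem mem_fixCols_iff {S : Set (Fin n)} {g : GL (Fin n) F} :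
    g ∈ fixCols F n S ↔ ∀ j ∈ S, ∀ i, g.val i j = (1 : Matrix (Fin n) (Fin n) F) i j :=
  Iff.rfl

/-- Invertible matrices whose rows indexed by `S` are identity rows (`e_iᵀ g = e_iᵀ`, `i ∈ S`). [folklore] -/
def fixRows (S : Set (Fin n)) : Subgroup (GL (Fin n) F) where
  carrier := {g | ∀ i ∈ S, ∀ j, g.val i j = (1 : Matrix (Fin n) (Fin n) F) i j}
  one_mem' := fun _ _ _ => rfl
  mul_mem' {a b} ha hb := fun i hi j => by
    rw [Units.val_mul, Matrix.mul_apply]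
    calc ∑ l, a.val i l * b.val l j
        = ∑ l, (1 : Matrix (Fin n) (Fin n) F) i l * b.val l j :=
          Finset.sum_congr rfl fun l _ => by rw [ha i hi l]
      _ = b.val i j := by rw [← Matrix.mul_apply, Matrix.one_mul]
      _ = _ := hb i hi j
  inv_mem' {a} ha := fun i hi j => by
    have h1 : (a.val * (a⁻¹ : GL (Fin n) F).val) i j = (1 : Matrix (Fin n) (Fin n) F) i j := by
      rw [← Units.val_mul, mul_inv_cancel, Units.val_one]
    rw [← h1, Matrix.mul_apply]
    calc (a⁻¹ : GL (Fin n) F).val i j = ((1 : Matrix (Fin n) (Fin n) F) * (a⁻¹ : GL (Fin n) F).val) i j := by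
          rw [Matrix.one_mul]
      _ = ∑ l, (1 : Matrix (Fin n) (Fin n) F) i l * (a⁻¹ : GL (Fin n) F).val l j := by rw [Matrix.mul_apply]
      _ = ∑ l, a.val i l * (a⁻¹ : GL (Fin n) F).val l j :=
          Finset.sum_congr rfl fun l _ => by rw [ha i hi l]

/-- Membership in `fixRows`. [folklore] -/
theorem mem_fixRows_iff {S : Set (Fin n)} {g : GL (Fin n) F} :
    g ∈ fixRows F n S ↔ ∀ i ∈ S, ∀ j, g.val i j = (1 : Matrix (Fin n) (Fin n) F) i j :=
  Iff.rfl

/-! ### The upper unitriangular group -/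

/-- `M` is upper unitriangular: zero below the diagonal, ones on it. [folklore] -/
def IsUnitUpper (M : Matrix (Fin n) (Fin n) F) : Prop :=
  (∀ i j, j < i → M i j = 0) ∧ ∀ i, M i i = 1

/-- An upper unitriangular matrix is block triangular for `id`. [folklore] -/
theorem IsUnitUpper.blockTriangular {M : Matrix (Fin n) (Fin n) F} (h : IsUnitUpper F n M) :
    M.BlockTriangular id := fun _ _ hij => h.1 _ _ hij

/-- The identity is upper unitriangular. [folklore] -/
theorem isUnitUpper_one : IsUnitUpper F n (1 : Matrix (Fin n) (Fin n) F) :=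
  ⟨fun _ _ hij => Matrix.one_apply_ne (ne_of_gt hij), fun i => Matrix.one_apply_eq i⟩

/-- An entry of a product of upper triangular matrices is a sum over `i ≤ l ≤ j` only; in
particular the diagonal is multiplicative and the superdiagonal additive. [folklore] -/
theorem IsUnitUpper.mul {M N : Matrix (Fin n) (Fin n) F} (hM : IsUnitUpper F n M) (hN : IsUnitUpper F n N) :
    IsUnitUpper F n (M * N) := by
  refine ⟨fun i j hij => ?_, fun i => ?_⟩
  · exact (hM.blockTriangular.mul hN.blockTriangular) hij
  · rw [Matrix.mul_apply, Finset.sum_eq_single i, hM.2, hN.2, mul_one]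
    · intro l _ hl
      rcases lt_or_gt_of_ne hl with h | h
      · rw [hM.1 _ _ h, zero_mul]
      · rw [hN.1 _ _ h, mul_zero]
    · exact fun h => (h (Finset.mem_univ _)).elim

/-- The inverse of an upper unitriangular invertible matrix is upper unitriangular. [folklore] -/
theorem IsUnitUpper.inv {g : GL (Fin n) F} (h : IsUnitUpper F n g.val) :
    IsUnitUpper F n ((g⁻¹ : GL (Fin n) F) : Matrix (Fin n) (Fin n) F) := by
  have htri : ((g⁻¹ : GL (Fin n) F) : Matrix (Fin n) (Fin n) F).BlockTriangular id := by
    rw [Matrix.coe_units_inv]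
    exact Matrix.blockTriangular_inv_of_blockTriangular h.blockTriangular
  refine ⟨fun i j hij => htri hij, fun i => ?_⟩
  -- `(g⁻¹ g)_{ii} = (g⁻¹)_{ii} g_{ii}`
  have h1 : ∑ l, (g⁻¹ : GL (Fin n) F).val i l * g.val l i = 1 := by
    rw [← Matrix.mul_apply, ← Units.val_mul, inv_mul_cancel, Units.val_one, Matrix.one_apply_eq]
  rw [Finset.sum_eq_single i, h.2, mul_one] at h1
  · exact h1
  · intro l _ hl
    rcases lt_or_gt_of_ne hl with h' | h'
    · rw [htri h', zero_mul]
    · rw [h.1 _ _ h', mul_zero]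
  · exact fun h => (h (Finset.mem_univ _)).elim

/-- The **upper unitriangular group** `U_n ≤ GL_n(F)`. [folklore] -/
def unitUpper : Subgroup (GL (Fin n) F) where
  carrier := {g | IsUnitUpper F n g.val}
  one_mem' := by simpa using isUnitUpper_one F n
  mul_mem' {a b} ha hb := by
    show IsUnitUpper F n (a * b : GL (Fin n) F).val
    rw [Units.val_mul]; exact IsUnitUpper.mul F n ha hb
  inv_mem' {a} ha := IsUnitUpper.inv F n ha

/-- Membership in `U_n`. [folklore] -/
theorem mem_unitUpper_iff {g : GL (Fin n) F} :
    g ∈ unitUpper F n ↔ IsUnitUpper F n g.val :=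
  Iff.rfl

/-- An upper unitriangular matrix has determinant `1`. [folklore] -/
theorem IsUnitUpper.det_eq_one {M : Matrix (Fin n) (Fin n) F} (h : IsUnitUpper F n M) : M.det = 1 := by
  rw [Matrix.det_of_upperTriangular h.blockTriangular]
  exact Finset.prod_eq_one fun i _ => h.2 i

/-- Package an upper unitriangular matrix as an element of `GL_n(F)`. [folklore] -/
noncomputable def unitUpperMk (M : Matrix (Fin n) (Fin n) F) (h : IsUnitUpper F n M) : GL (Fin n) F :=
  Matrix.GeneralLinearGroup.mkOfDetNeZero M (by rw [h.det_eq_one]; exact one_ne_zero)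

/-- Underlying matrix of `unitUpperMk`. [folklore] -/
@[simp] theorem coe_unitUpperMk (M : Matrix (Fin n) (Fin n) F) (h : IsUnitUpper F n M) :
    (unitUpperMk F n M h : Matrix (Fin n) (Fin n) F) = M := rfl

/-- `unitUpperMk` lands in `U_n`. [folklore] -/
theorem unitUpperMk_mem (M : Matrix (Fin n) (Fin n) F) (h : IsUnitUpper F n M) :
    unitUpperMk F n M h ∈ unitUpper F n := h

/-! ### Pattern subgroups: tails, columns, the Levi block -/

/-- `N_t = U_n ⊓ fixCols {j < t}`: unipotent matrices supported in the columns `≥ t`. [folklore] -/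
def tailGroup (t : ℕ) : Subgroup (GL (Fin n) F) :=
  unitUpper F n ⊓ fixCols F n {j | j.val < t}

/-- The **column group** `V_c = U_n ⊓ fixCols {j ≠ c} = {1 + ∑_{i<c} x_i E_{ic}} ≅ F^c`. [folklore] -/
def colGroup (c : Fin n) : Subgroup (GL (Fin n) F) :=
  unitUpper F n ⊓ fixCols F n {j | j ≠ c}

/-- The **Levi block** `GL_k ↪ GL_n`, `A ↦ diag(A, 1)`: matrices with identity rows and columns `≥ k`. [folklore] -/
def leviBlock (k : ℕ) : Subgroup (GL (Fin n) F) :=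
  fixCols F n {j | k ≤ j.val} ⊓ fixRows F n {i | k ≤ i.val}

/-- Membership in `tailGroup`. [folklore] -/
theorem mem_tailGroup_iff {t : ℕ} {g : GL (Fin n) F} :
    g ∈ tailGroup F n t ↔ IsUnitUpper F n g.val ∧
      ∀ j : Fin n, j.val < t → ∀ i, g.val i j = (1 : Matrix (Fin n) (Fin n) F) i j :=
  Iff.rfl

/-- Membership in `colGroup`. [folklore] -/
theorem mem_colGroup_iff {c : Fin n} {g : GL (Fin n) F} :
    g ∈ colGroup F n c ↔ IsUnitUpper F n g.val ∧
      ∀ j : Fin n, j ≠ c → ∀ i, g.val i j = (1 : Matrix (Fin n) (Fin n) F) i j :=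
  Iff.rfl

/-- Membership in `leviBlock`. [folklore] -/
theorem mem_leviBlock_iff {k : ℕ} {g : GL (Fin n) F} :
    g ∈ leviBlock F n k ↔
      (∀ j : Fin n, k ≤ j.val → ∀ i, g.val i j = (1 : Matrix (Fin n) (Fin n) F) i j) ∧
      ∀ i : Fin n, k ≤ i.val → ∀ j, g.val i j = (1 : Matrix (Fin n) (Fin n) F) i j :=
  Iff.rfl

/-- `tailGroup 1 = U_n` (column `0` of a unitriangular matrix is `e_0` anyway). [folklore] -/
theorem mem_tailGroup_one_iff {g : GL (Fin n) F} : g ∈ tailGroup F n 1 ↔ g ∈ unitUpper F n := by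
  rw [mem_tailGroup_iff, mem_unitUpper_iff]
  refine ⟨fun h => h.1, fun h => ⟨h, fun j hj i => ?_⟩⟩
  by_cases hij : i = j
  · subst hij; rw [h.2, Matrix.one_apply_eq]
  · have hlt : j < i := by
      rw [Fin.lt_def]
      have := Fin.val_ne_of_ne hij
      omega
    rw [h.1 _ _ hlt, Matrix.one_apply_ne hij]

/-- `tailGroup t = 1` once `n ≤ t`. [folklore] -/
theorem mem_tailGroup_of_le {t : ℕ} (ht : n ≤ t) {g : GL (Fin n) F} : g ∈ tailGroup F n t ↔ g = 1 := by
  rw [mem_tailGroup_iff]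
  constructor
  · rintro ⟨-, h⟩
    ext i j
    exact h j (lt_of_lt_of_le j.2 ht) i
  · rintro rfl
    exact ⟨by simpa using isUnitUpper_one F n, fun _ _ _ => rfl⟩

/-- `tailGroup` is antitone in `t`. [folklore] -/
theorem tailGroup_mono {s t : ℕ} (h : s ≤ t) : tailGroup F n t ≤ tailGroup F n s :=
  fun _ hg => ⟨hg.1, fun j hj i => hg.2 j (lt_of_lt_of_le hj h) i⟩

/-! ### Column group elements -/

/-- The strictly upper part of column `c`: `X = ∑_{i<c} x_i E_{ic}`. [folklore] -/
def colMatrix (c : Fin n) (x : Fin n → F) : Matrix (Fin n) (Fin n) F :=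
  Matrix.of fun i j => if j = c ∧ i < c then x i else 0

/-- Entries of `colMatrix`. [folklore] -/
@[simp] theorem colMatrix_apply (c : Fin n) (x : Fin n → F) (i j : Fin n) :
    colMatrix F n c x i j = if j = c ∧ i < c then x i else 0 := rfl

/-- `X X' = 0` for two column-`c` matrices. [folklore] -/
theorem colMatrix_mul_colMatrix (c : Fin n) (x x' : Fin n → F) :
    colMatrix F n c x * colMatrix F n c x' = 0 := by
  ext i j
  rw [Matrix.mul_apply, Matrix.zero_apply]
  refine Finset.sum_eq_zero fun l _ => ?_
  simp only [colMatrix_apply]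
  by_cases h1 : l = c ∧ i < c
  · rw [if_neg (show ¬(j = c ∧ l < c) from fun h2 => lt_irrefl c (h1.1 ▸ h2.2)), mul_zero]
  · rw [if_neg h1, zero_mul]

/-- `1 + X` is upper unitriangular for a column matrix `X`. [folklore] -/
theorem isUnitUpper_one_add_colMatrix (c : Fin n) (x : Fin n → F) :
    IsUnitUpper F n (1 + colMatrix F n c x) := by
  refine ⟨fun i j hij => ?_, fun i => ?_⟩
  · rw [Matrix.add_apply, Matrix.one_apply_ne (ne_of_gt hij), colMatrix_apply, if_neg, add_zero]
    rintro ⟨rfl, h⟩; exact lt_asymm hij h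
  · rw [Matrix.add_apply, Matrix.one_apply_eq, colMatrix_apply, if_neg, add_zero]
    rintro ⟨rfl, h⟩; exact lt_irrefl _ h

/-- **`colElem c x = 1 + ∑_{i<c} x_i E_{ic}`**, an element of the column group `V_c`. [folklore] -/
noncomputable def colElem (c : Fin n) (x : Fin n → F) : GL (Fin n) F :=
  unitUpperMk F n (1 + colMatrix F n c x) (isUnitUpper_one_add_colMatrix F n c x)

/-- Underlying matrix of `colElem`. [folklore] -/
@[simp] theorem coe_colElem (c : Fin n) (x : Fin n → F) :
    (colElem F n c x : Matrix (Fin n) (Fin n) F) = 1 + colMatrix F n c x := rfl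

/-- Entries of `colElem`. [folklore] -/
theorem colElem_apply (c : Fin n) (x : Fin n → F) (i j : Fin n) :
    (colElem F n c x : Matrix (Fin n) (Fin n) F) i j =
      (1 : Matrix (Fin n) (Fin n) F) i j + if j = c ∧ i < c then x i else 0 := rfl

/-- `colElem c x · colElem c x' = colElem c (x + x')`: `V_c ≅ (F^c, +)`. [folklore] -/
theorem colElem_mul (c : Fin n) (x x' : Fin n → F) :
    colElem F n c x * colElem F n c x' = colElem F n c (x + x') := by
  apply Units.ext
  rw [Units.val_mul, coe_colElem, coe_colElem, coe_colElem, add_mul, mul_add, mul_add, one_mul, mul_one,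
    one_mul, colMatrix_mul_colMatrix, add_zero, add_assoc]
  congr 1
  ext i j
  simp only [Matrix.add_apply, colMatrix_apply, Pi.add_apply]
  split_ifs <;> ring

/-- `colElem c 0 = 1`. [folklore] -/
theorem colElem_zero (c : Fin n) : colElem F n c (0 : Fin n → F) = 1 := by
  apply Units.ext
  rw [coe_colElem, Units.val_one]
  ext i j
  simp [Matrix.add_apply, colMatrix_apply]

/-- `colElem c x ∈ V_c`. [folklore] -/
theorem colElem_mem (c : Fin n) (x : Fin n → F) : colElem F n c x ∈ colGroup F n c := by
  refine ⟨isUnitUpper_one_add_colMatrix F n c x, fun j hj i => ?_⟩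
  rw [colElem_apply, if_neg (fun h => hj h.1), add_zero]

/-- Every element of `V_c` is a `colElem`. [folklore] -/
theorem eq_colElem_of_mem {c : Fin n} {g : GL (Fin n) F} (hg : g ∈ colGroup F n c) :
    g = colElem F n c (fun i => g.val i c) := by
  apply Units.ext
  ext i j
  rw [colElem_apply]
  by_cases hjc : j = c
  · subst hjc
    by_cases hic : i < j
    · rw [if_pos ⟨rfl, hic⟩, Matrix.one_apply_ne (ne_of_lt hic), zero_add]
    · rw [if_neg (fun h => hic h.2), add_zero]
      rcases (not_lt.mp hic).lt_or_eq with h | h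
      · rw [hg.1.1 _ _ h, Matrix.one_apply_ne (ne_of_gt h)]
      · rw [h, hg.1.2, Matrix.one_apply_eq]
  · rw [if_neg (fun h => hjc h.1), add_zero, hg.2 j hjc i]

/-- `V_c` is abelian. [folklore] -/
instance isMulCommutative_colGroup (c : Fin n) : IsMulCommutative (colGroup F n c) :=
  ⟨⟨fun a b => Subtype.ext (by
    rw [Subgroup.coe_mul, Subgroup.coe_mul, eq_colElem_of_mem F n a.2, eq_colElem_of_mem F n b.2,
      colElem_mul, colElem_mul, add_comm])⟩⟩

/-! ### The characters `θ_t(g) = ψ₀(∑_{t ≤ i+1} g_{i,i+1})` -/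

/-- The superdiagonal entry `g_{i,i+1}` (`0` if `i = n-1`). [folklore] -/
def superdiag (M : Matrix (Fin n) (Fin n) F) (i : Fin n) : F :=
  if h : i.val + 1 < n then M i ⟨i.val + 1, h⟩ else 0

/-- `∑_{i : t ≤ i+1} g_{i,i+1}`, the sum of the superdiagonal entries in the columns `≥ t`. [folklore] -/
def superdiagSum (t : ℕ) (M : Matrix (Fin n) (Fin n) F) : F :=
  ∑ i : Fin n, if t ≤ i.val + 1 then superdiag F n M i else 0

/-- The superdiagonal of a product of unitriangular matrices is additive. [folklore] -/
theorem superdiag_mul {M N : Matrix (Fin n) (Fin n) F} (hM : IsUnitUpper F n M) (hN : IsUnitUpper F n N)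
    (i : Fin n) : superdiag F n (M * N) i = superdiag F n M i + superdiag F n N i := by
  unfold superdiag
  split_ifs with h
  · set j : Fin n := ⟨i.val + 1, h⟩
    have hij : i ≠ j := fun e => by have := congrArg Fin.val e; simp [j] at this
    rw [Matrix.mul_apply, Finset.sum_eq_add i j hij, hM.2, hN.2, one_mul, mul_one, add_comm]
    · intro l _ hl
      rcases lt_or_gt_of_ne hl.1 with h1 | h1
      · rw [hM.1 _ _ h1, zero_mul]
      · have h2 : j < l := by
          rcases lt_or_gt_of_ne hl.2 with h2 | h2
          · exfalso
            have : l.val < i.val + 1 := h2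
            have : i.val < l.val := h1
            omega
          · exact h2
        rw [hN.1 _ _ h2, mul_zero]
    · simp
    · simp
  · simp

/-- `superdiagSum` is additive on products of unitriangular matrices. [folklore] -/
theorem superdiagSum_mul (t : ℕ) {M N : Matrix (Fin n) (Fin n) F} (hM : IsUnitUpper F n M)
    (hN : IsUnitUpper F n N) :
    superdiagSum F n t (M * N) = superdiagSum F n t M + superdiagSum F n t N := by
  unfold superdiagSum
  rw [← Finset.sum_add_distrib]
  refine Finset.sum_congr rfl fun i _ => ?_
  split_ifs
  · exact superdiag_mul F n hM hN i
  · simp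

/-- `superdiagSum t 1 = 0`. [folklore] -/
theorem superdiagSum_one (t : ℕ) : superdiagSum F n t (1 : Matrix (Fin n) (Fin n) F) = 0 := by
  unfold superdiagSum superdiag
  refine Finset.sum_eq_zero fun i _ => ?_
  split_ifs with h1 h2
  · exact Matrix.one_apply_ne (fun e => by have := congrArg Fin.val e; simp at this)
  · rfl
  · rfl

variable {F n}

/-- **`θ_t(g) = ψ₀(∑_{t ≤ i+1} g_{i,i+1})`**; `θ_1 = ψ_U` is the non-degenerate character of `U_n`,
and `θ_t` is its restriction "to the columns `≥ t`". [folklore] -/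
noncomputable def theta (ψ₀ : AddChar F ℂ) (t : ℕ) (g : GL (Fin n) F) : ℂ :=
  ψ₀ (superdiagSum F n t g.val)

/-- `θ_t(1) = 1`. [folklore] -/
theorem theta_one (ψ₀ : AddChar F ℂ) (t : ℕ) : theta ψ₀ t (1 : GL (Fin n) F) = 1 := by
  rw [theta, Units.val_one, superdiagSum_one, AddChar.map_zero_eq_one]

/-- `θ_t` is multiplicative on `U_n`. [folklore] -/
theorem theta_mul (ψ₀ : AddChar F ℂ) (t : ℕ) {g h : GL (Fin n) F} (hg : g ∈ unitUpper F n)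
    (hh : h ∈ unitUpper F n) : theta ψ₀ t (g * h) = theta ψ₀ t g * theta ψ₀ t h := by
  rw [theta, Units.val_mul, superdiagSum_mul F n t hg hh, AddChar.map_add_eq_mul]
  rfl

/-- `θ_t(g⁻¹) θ_t(g) = 1` on `U_n`. [folklore] -/
theorem theta_inv (ψ₀ : AddChar F ℂ) (t : ℕ) {g : GL (Fin n) F} (hg : g ∈ unitUpper F n) :
    theta ψ₀ t g⁻¹ * theta ψ₀ t g = 1 := by
  rw [← theta_mul ψ₀ t ((unitUpper F n).inv_mem hg) hg, inv_mul_cancel, theta_one]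

/-- `θ_t` does not vanish on `U_n`. [folklore] -/
theorem theta_ne_zero (ψ₀ : AddChar F ℂ) (t : ℕ) {g : GL (Fin n) F} (hg : g ∈ unitUpper F n) :
    theta ψ₀ t g ≠ 0 := fun h => by
  have := theta_inv ψ₀ t hg
  rw [h, mul_zero] at this
  exact zero_ne_one this

/-- `θ_t` as a homomorphism `H →* ℂˣ` on any subgroup `H ≤ U_n`. [folklore] -/
noncomputable def thetaHom (ψ₀ : AddChar F ℂ) (t : ℕ) (H : Subgroup (GL (Fin n) F)) (hH : H ≤ unitUpper F n) :
    H →* ℂˣ where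
  toFun u := Units.mk0 (theta ψ₀ t (u : GL (Fin n) F)) (theta_ne_zero ψ₀ t (hH u.2))
  map_one' := Units.ext (by simp [theta_one])
  map_mul' a b := Units.ext (by simp [theta_mul ψ₀ t (hH a.2) (hH b.2)])

/-- `thetaHom` unfolded. [folklore] -/
@[simp] theorem coe_thetaHom_apply (ψ₀ : AddChar F ℂ) (t : ℕ) (H : Subgroup (GL (Fin n) F))
    (hH : H ≤ unitUpper F n) (u : H) :
    (thetaHom ψ₀ t H hH u : ℂ) = theta ψ₀ t (u : GL (Fin n) F) := rfl

/-- `tailGroup t ≤ U_n`. [folklore] -/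
theorem tailGroup_le_unitUpper (t : ℕ) : tailGroup F n t ≤ unitUpper F n := inf_le_left

/-- `colGroup c ≤ U_n`. [folklore] -/
theorem colGroup_le_unitUpper (c : Fin n) : colGroup F n c ≤ unitUpper F n := inf_le_left

/-! ### Characters of the column groups -/

/-- **`θ_y(g) = ψ₀(∑_{i<c} y_i g_{ic})`**: on the column group `V_c ≅ F^c` these are the characters
`x ↦ ψ₀(y · x)`. [folklore] -/
noncomputable def colChar (ψ₀ : AddChar F ℂ) (c : Fin n) (y : Fin n → F) (g : GL (Fin n) F) : ℂ :=
  ψ₀ (∑ i : Fin n, if i < c then y i * g.val i c else 0)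

/-- `θ_y(colElem c x) = ψ₀(∑_{i<c} y_i x_i)`. [folklore] -/
theorem colChar_colElem (ψ₀ : AddChar F ℂ) (c : Fin n) (y x : Fin n → F) :
    colChar ψ₀ c y (colElem F n c x) = ψ₀ (∑ i : Fin n, if i < c then y i * x i else 0) := by
  unfold colChar
  congr 1
  refine Finset.sum_congr rfl fun i _ => ?_
  split_ifs with h
  · rw [colElem_apply, if_pos ⟨rfl, h⟩, Matrix.one_apply_ne (ne_of_lt h), zero_add]
  · rfl

/-- `θ_y(1) = 1`. [folklore] -/
theorem colChar_one (ψ₀ : AddChar F ℂ) (c : Fin n) (y : Fin n → F) : colChar ψ₀ c y (1 : GL (Fin n) F) = 1 := by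
  rw [← colElem_zero, colChar_colElem]
  simp

/-- `θ_y` is multiplicative on `V_c`. [folklore] -/
theorem colChar_mul (ψ₀ : AddChar F ℂ) (c : Fin n) (y : Fin n → F) {g h : GL (Fin n) F}
    (hg : g ∈ colGroup F n c) (hh : h ∈ colGroup F n c) :
    colChar ψ₀ c y (g * h) = colChar ψ₀ c y g * colChar ψ₀ c y h := by
  rw [eq_colElem_of_mem F n hg, eq_colElem_of_mem F n hh, colElem_mul, colChar_colElem, colChar_colElem,
    colChar_colElem, ← AddChar.map_add_eq_mul, ← Finset.sum_add_distrib]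
  congr 1
  refine Finset.sum_congr rfl fun i _ => ?_
  split_ifs
  · simp only [Pi.add_apply]; ring
  · simp

/-- The trivial character is `θ_0`. [folklore] -/
theorem colChar_zero (ψ₀ : AddChar F ℂ) (c : Fin n) (g : GL (Fin n) F) : colChar ψ₀ c 0 g = 1 := by
  simp [colChar]

end Literature.RepresentationTheory.FiniteGroups.GLn
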